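import Summits.BirchSwinnertonDyer.BirchSwinnertonDyer.Theorems.ManinLocalTwoThreeNoAscendingTameThree
import Summits.BirchSwinnertonDyer.BirchSwinnertonDyer.Theorems.ManinLocalTwoThreeThreeTorsionAscentIffCongruence
import Summits.BirchSwinnertonDyer.BirchSwinnertonDyer.Theorems.ManinLocalTwoThreeTameAdditiveTypesAtThree
import Literature.NumberTheory.EllipticCurves.RootNumberTableThreeKodairaProofs
import HarnessLib

/-!
# Off the `III` stratum of the tame band at `3`, a rational `3`-torsion point satisfies the `z⁹` congruence
# `Y₁ ≡ 4(α/3)³ (mod 9)` — the local converse behind the v15 split of line `kato_shift_three`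

Summit `BirchSwinnertonDyer`, route `ManinLocalTwoThree` (cell bsd-f2-manin), deciding crux C3 `ManinPrimeToThreeAtNine`
(stmt-BirchSwinnertonDyer-22968), line `kato_shift_three` (v15: stub NB₃^V split into an's position law T3III = E-an-112 on the
tame band + a wild remainder, the `III`/`III*` strata being p3's theorem p649622).  THIS FILE is the computational core of the
LOCAL CONVERSE «tame, not `III` ⟹ every rational `3`-torsion point ASCENDS»; the ascent itself, the dichotomy and the stub
equivalence T3III ⟺ NB₃^V|tame are in the sequel `…TameThreeTorsionAscends.lean`.

* §1 `hasAdditiveReductionAt_three_of_nine_dvd_conductorNorm`, `norm_shortModel_le_one_of_nine_dvd_conductorNorm` — datum-free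
  `3`-integrality of `E♮ = E_{W,1}` at `9 ∣ N(W)` (additive reduction, `f₃ ≥ 2`; re-proving the eight lines of route
  AlignedTransportAtTwo's `hasAdditiveReductionAt_of_sq_dvd_conductorNorm` to keep the imports inside this route).
* §2 `c₄_c₆_Δ_eq_of_isShortThreeTorsion_flex` — on the flex chart of `T = (X₁, Y₁)` (`α` = tangent slope, `α² = 3X₁`, `s = α/3`)
  the invariants of `W` itself are `c₄ = 144·s·(9s³ − 2Y₁)`, `c₆ = −864·(Y₁² − 18s³Y₁ + 54s⁶)`, `Δ = 432·Y₁³·(4s³ − Y₁)`.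
* §4 `norm_congruence_le_one_of_isShortThreeTorsion_of_tame_of_ne_III` — `W` globally minimal, `9 ∥ N(W)`, `ord₃ Δ_min ≠ 3`,
  `T` of order `3` on `E♮` ⟹ `‖(Y₁ − 4(α/3)³)/9‖₃ ≤ 1`.

THE PROOF of §4.  `s, Y₁ ∈ ℤ₃` (p1's `norm_tangentSlope_div_three_le_one`), `27 ∤ Y₁` (p1's
`one_lt_norm_div_twentyseven_of_isShortThreeTorsion`), `Δ = Δ_min` (global minimality), so
`ord₃ Δ_min = 3 + 3·ord₃ Y₁ + ord₃ (4s³ − Y₁)`.  If `9 ∤ Y₁ − 4s³`: `ord₃ Y₁ = 0` gives `ord₃ Δ_min ∈ {3, 4}` — type `III`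
(excluded) or no tame type (the tree's exhaustion `padicValInt_three_minimalDiscriminantInt_of_nine_dvd_conductorNorm`:
`9 ∥ N ⟹ (III, 3) ∨ (I₀*, 6) ∨ (III*, 9) ∨ (Iₙ₊₁*, n + 7, ord₃ j < 0)`); `ord₃ Y₁ = 1` gives either `ord₃ Δ_min = 7` with
`ord₃ j ≥ 5` or `j = 0` — not `I₁*` — or, when `s` is a unit, the Papadopoulos–Rizzo triple `(ord₃ c₄, ord₃ c₆, ord₃ Δ) = (3, 5, 6)`,
which is type `IV` by the tree's kernel form of Tate's algorithm at `3` (`kodairaSymbolAt_eq_tableKodairaSymbolThree`,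
`Rizzo.kodaira_row_3_5_6`) — against the tame types; `ord₃ Y₁ = 2` forces `s` a unit, `ord₃ Δ_min = 9`, `ord₃ j ≥ 3`: potentially
good `III*`, which carries no rational `3`-torsion (p3's `not_isShortThreeTorsion_of_IIIstar`).

HONEST FRAMING: local theorems about rational `3`-torsion at a tame additive prime `3`; T3III, NB₃^V, C3, Manin's conjecture and
BSD are NOT proved.  No definitions, no named facts, no sorry.
References: [SilvermanATAEC1994] IV.9.4 and Table 4.1, IV.10.2; [Papadopoulos1993] Table III (`p = 3`); [Rizzo2003] Table II;
[DokchitserDokchitser2015LocalInvariants] Table 1; [SilvermanAEC2009] III.1, VII.5.1; HOME/MEMO-an.md §66–§67.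
-/
set_option linter.dupNamespace false
set_option autoImplicit false

noncomputable section

open scoped Classical

open WeierstrassCurve IsDedekindDomain NumberField Rat.HeightOneSpectrum Polynomial
  Literature.NumberTheory.DiophantineGeometry Literature.NumberTheory.EllipticCurves
  Literature.NumberTheory.EllipticCurves.ModularForms
  Summit.BirchSwinnertonDyer.Rank1Residual.Additive
  Summit.BirchSwinnertonDyer.Rank1Residual.ManinAdditive
  Summit.BirchSwinnertonDyer.Rank1Residual.ManinAdditive.CuspidalKummer
  Summit.BirchSwinnertonDyer.Rank1Residual.ManinAdditive.CuspidalKummerThree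

namespace Summit.BirchSwinnertonDyer.BirchSwinnertonDyer.Theorems.ManinLocalTwoThree

/-! ### §0 `3`-adic valuation helpers -/

/-- `‖q‖₃ ≤ 1 ↔ 0 ≤ ord₃ q` for a rational `q` (also for `q = 0`, both sides being true). [folklore] -/
theorem norm_ratCast_padicThree_le_one_iff (q : ℚ) : ‖((q : ℚ) : ℚ_[3])‖ ≤ 1 ↔ 0 ≤ padicValRat 3 q := by
  rw [Padic.norm_le_one_iff_val_nonneg, Padic.valuation_ratCast]

/-- `ord₃ (3ᵏ·m) = k` for `3 ∤ m` (natural-number constants). [folklore] -/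
theorem padicValRat_three_natCast_of_eq {n : ℕ} (k : ℕ) {m : ℕ} (h : n = 3 ^ k * m) (hm : ¬ 3 ∣ m) :
    padicValRat 3 (n : ℚ) = k := by
  have hm0 : m ≠ 0 := by rintro rfl; exact hm (dvd_zero 3)
  rw [padicValRat.of_nat, h, padicValNat.mul (pow_ne_zero k (by norm_num)) hm0, padicValNat.prime_pow,
    padicValNat.eq_zero_of_not_dvd hm]
  push_cast; ring

/-- `ord₃` of a product of three nonzero rationals. [folklore] -/
theorem padicValRat_three_mul₃ {a b c : ℚ} (ha : a ≠ 0) (hb : b ≠ 0) (hc : c ≠ 0) :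
    padicValRat 3 (a * b * c) = padicValRat 3 a + padicValRat 3 b + padicValRat 3 c := by
  rw [padicValRat.mul (mul_ne_zero ha hb) hc, padicValRat.mul ha hb]

/-! ### §1 Additive reduction at `3` from `9 ∣ N(W)`; the `3`-integral short model -/

/-- `9 ∣ N(W)` ⟹ additive reduction at the `𝓞 ℚ`-place over `3` (`f₃ ≥ 2 ⟺` additive, Ogg–Saito as the tree's definition
of `f_v`; the eight lines of `hasAdditiveReductionAt_of_sq_dvd_conductorNorm` of route `AlignedTransportAtTwo`, re-proved here to
keep the imports inside this route). [cite: SilvermanATAEC1994, IV.10.2 (c)] -/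
theorem hasAdditiveReductionAt_three_of_nine_dvd_conductorNorm (W : WeierstrassCurve ℚ) [W.IsElliptic]
    (h9 : 3 ^ 2 ∣ W.conductorNorm ℤ) :
    W.HasAdditiveReductionAt ((primesEquiv (R := 𝓞 ℚ)).symm ⟨3, Nat.prime_three⟩) := by
  set v : HeightOneSpectrum ℤ := (primesEquiv (R := ℤ)).symm ⟨3, Nat.prime_three⟩ with hv
  haveI : PerfectField (IsLocalRing.ResidueField (v.adicCompletionIntegers ℚ)) := PerfectField.ofFinite
  have hgen : natGenerator v = 3 :=
    congrArg (fun q : Nat.Primes ↦ (q : ℕ)) ((primesEquiv (R := ℤ)).apply_symm_apply ⟨3, Nat.prime_three⟩)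
  have hfac : 2 ≤ (W.conductorNorm ℤ).factorization 3 := by
    have h := (Nat.factorization_le_iff_dvd (pow_ne_zero 2 (by norm_num)) (W.conductorNorm_pos_holds).ne').mpr h9
    have h' := h 3
    rwa [Nat.factorization_pow, Finsupp.smul_apply, smul_eq_mul, Nat.prime_three.factorization_self, mul_one] at h'
  have hadd : W.HasAdditiveReductionAt v := by
    rw [← two_le_conductorExponent_iff_holds v W, ← factorization_conductorNorm_holds W v, hgen]
    exact hfac
  exact (W.hasAdditiveReductionAt_int_iff_ringOfIntegers ⟨3, Nat.prime_three⟩).mp hadd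

/-- **`9 ∣ N(W)` ⟹ `E♮ = E_{W,1}` is `3`-integral** (`W` globally minimal): additive reduction gives `3 ∣ Δ_min`, `3 ∣ c₄`, whence
`27 ∣ c₆` and the `ℤ₃`-model of p3's `exists_padicInt_shortModel_three`.  The datum-free form of
`norm_shortModel_le_one_of_nine_dvd`. [cite: SilvermanAEC2009, VII.5 Prop. 5.1 (c)] -/
theorem norm_shortModel_le_one_of_nine_dvd_conductorNorm (W : WeierstrassCurve ℚ) [W.IsElliptic] [W.IsGloballyMinimal]
    (h9 : 3 ^ 2 ∣ W.conductorNorm ℤ) :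
    ‖(((shortModel W 1).a₄ : ℚ) : ℚ_[3])‖ ≤ 1 ∧ ‖(((shortModel W 1).a₆ : ℚ) : ℚ_[3])‖ ≤ 1 := by
  obtain ⟨hΔ3, hc₄3⟩ := three_dvd_Δ_and_c₄_of_hasAdditiveReductionAt W
    (hasAdditiveReductionAt_three_of_nine_dvd_conductorNorm W h9)
  obtain ⟨V, -, -, -, hVE, -, -, -⟩ := exists_padicInt_shortModel_three W hΔ3 hc₄3
  have hrat : ∀ q : ℚ, algebraMap ℚ ℚ_[3] q = (q : ℚ_[3]) := fun q => by rw [eq_ratCast]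
  constructor
  · have h := congrArg WeierstrassCurve.a₄ hVE
    rw [map_a₄, map_a₄, hrat] at h
    rw [← h]; exact PadicInt.norm_le_one _
  · have h := congrArg WeierstrassCurve.a₆ hVE
    rw [map_a₆, map_a₆, hrat] at h
    rw [← h]; exact PadicInt.norm_le_one _

/-! ### §2 The invariants of `W` on the flex chart of a rational `3`-torsion point -/

/-- **The flex chart.**  For `T = (X₁, Y₁)` of order `3` on `E♮ = E_{W,1}` with tangent slope `α` and `s = α/3` (so `X₁ = 3s²`):
`c₄(W) = 144·s·(9s³ − 2Y₁)`, `c₆(W) = −864·(Y₁² − 18s³Y₁ + 54s⁶)`, `Δ(W) = 432·Y₁³·(4s³ − Y₁)` — the invariants of the chart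
`[2α, 0, 2Y₁, 0, 0] = [6s, 0, 2Y₁, 0, 0]` (`Δ = a₃³(a₁³ − 27a₃)`). [cite: SilvermanAEC2009, III.1 Table 3.1] -/
theorem c₄_c₆_Δ_eq_of_isShortThreeTorsion_flex (W : WeierstrassCurve ℚ) {X₁ Y₁ : ℚ} (hT : IsShortThreeTorsion W 1 X₁ Y₁) :
    W.c₄ = 144 * (tangentSlope W 1 X₁ Y₁ / 3) * (9 * (tangentSlope W 1 X₁ Y₁ / 3) ^ 3 - 2 * Y₁) ∧
    W.c₆ = -864 * (Y₁ ^ 2 - 18 * (tangentSlope W 1 X₁ Y₁ / 3) ^ 3 * Y₁ + 54 * (tangentSlope W 1 X₁ Y₁ / 3) ^ 6) ∧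
    W.Δ = 432 * Y₁ ^ 3 * (4 * (tangentSlope W 1 X₁ Y₁ / 3) ^ 3 - Y₁) := by
  obtain ⟨hc4, hc6⟩ := c₄_c₆_eq_of_isShortThreeTorsion W hT
  have hflex := tangentSlope_sq_eq_three_mul hT
  set α := tangentSlope W 1 X₁ Y₁ with hα
  have h4 : W.c₄ = 144 * (α / 3) * (9 * (α / 3) ^ 3 - 2 * Y₁) := by
    linear_combination hc4 - 16 * (α ^ 2 + 3 * X₁) * hflex
  have h6 : W.c₆ = -864 * (Y₁ ^ 2 - 18 * (α / 3) ^ 3 * Y₁ + 54 * (α / 3) ^ 6) := by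
    linear_combination hc6 + (64 * (α ^ 4 + 3 * α ^ 2 * X₁ + 9 * X₁ ^ 2) - 576 * α * Y₁) * hflex
  refine ⟨h4, h6, ?_⟩
  have hrel := W.c_relation
  rw [h4, h6] at hrel
  linear_combination hrel / 1728

/-! ### §3 More valuation helpers -/

/-- Ultrametric equality without the side condition on the sum: `q ≠ 0` and (`r = 0` or `ord₃ q < ord₃ r`) give
`ord₃ (q + r) = ord₃ q`. [folklore] -/
theorem padicValRat_three_add_eq_of_lt {q r : ℚ} (hq : q ≠ 0) (hval : r ≠ 0 → padicValRat 3 q < padicValRat 3 r) :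
    padicValRat 3 (q + r) = padicValRat 3 q := by
  by_cases hr : r = 0
  · rw [hr, add_zero]
  have hlt := hval hr
  have hqr : q + r ≠ 0 := by
    intro h
    have : r = -q := by linear_combination h
    rw [this, padicValRat.neg] at hlt
    exact lt_irrefl _ hlt
  exact padicValRat.add_eq_of_lt hqr hq hr hlt

/-- `ord₃ j(W) = 3·ord₃ c₄(W) − ord₃ Δ(W)` when `c₄(W) ≠ 0`. [folklore] -/
theorem padicValRat_three_j_eq (W : WeierstrassCurve ℚ) [W.IsElliptic] (hc₄ : W.c₄ ≠ 0) :
    padicValRat 3 W.j = 3 * padicValRat 3 W.c₄ - padicValRat 3 W.Δ := by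
  have hj : W.j = W.c₄ ^ 3 / W.Δ := by
    rw [WeierstrassCurve.j, Units.val_inv_eq_inv_val, coe_Δ', inv_mul_eq_div]
  rw [hj, padicValRat.div (pow_ne_zero 3 hc₄) W.isUnit_Δ.ne_zero, padicValRat.pow]
  push_cast; ring

/-- `ord₃ Δ_min(W) = ord₃ Δ(W)` for a globally minimal `W`. [folklore] -/
theorem padicValInt_minimalDiscriminantInt_eq_padicValRat_Δ (W : WeierstrassCurve ℚ) [W.IsGloballyMinimal] :
    (padicValInt 3 W.minimalDiscriminantInt : ℤ) = padicValRat 3 W.Δ := by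
  rw [← padicValRat.of_int, cast_minimalDiscriminantInt]

/-! ### §4 THE LOCAL THEOREM: off the `III` stratum of the tame band, a rational `3`-torsion point is congruent (ascends) -/

/-- **Tame at `3`, not of type `III` ⟹ every rational `3`-torsion point of `E♮` satisfies the `z⁹` congruence
`Y₁ ≡ 4(α/3)³ (mod 9)`** (`W` globally minimal, `9 ∥ N(W)`, `ord₃ Δ_min ≠ 3`).  Proof on the flex chart (`s = α/3`, `Y₁`
`3`-integral, `27 ∤ Y₁`): `ord₃ Δ = 3 + 3·ord₃ Y₁ + ord₃ (4s³ − Y₁)`; if the congruence failed, then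
`ord₃ Y₁ = 0` gives `ord₃ Δ ∈ {3, 4}` (type `III`, excluded, or no tame type); `ord₃ Y₁ = 1` gives either `ord₃ Δ = 7` with
`ord₃ j ≥ 5` (no tame type: `I₁*` is potentially multiplicative) or, when `s` is a unit, the Papadopoulos–Rizzo triple
`(ord₃ c₄, ord₃ c₆, ord₃ Δ) = (3, 5, 6)` = type `IV` (wild), against the tame types `III / I₀* / III* / Iₙ*`; `ord₃ Y₁ = 2`
forces `s` a unit, `ord₃ Δ = 9`, `ord₃ j ≥ 3`, i.e. potentially-good `III*`, which carries no rational `3`-torsion (p3).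
[cite: SilvermanATAEC1994, IV.9.4 Table 4.1] [cite: Papadopoulos1993, Table III (p = 3)] [cite: Rizzo2003, Table II (p. 4)] -/
theorem norm_congruence_le_one_of_isShortThreeTorsion_of_tame_of_ne_III (W : WeierstrassCurve ℚ) [W.IsElliptic]
    [W.IsGloballyMinimal] (h9 : 3 ^ 2 ∣ W.conductorNorm ℤ) (h27 : ¬ 3 ^ 3 ∣ W.conductorNorm ℤ)
    (hΔ3 : padicValInt 3 W.minimalDiscriminantInt ≠ 3) {X₁ Y₁ : ℚ} (hT : IsShortThreeTorsion W 1 X₁ Y₁) :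
    ‖(((Y₁ - 4 * (tangentSlope W 1 X₁ Y₁ / 3) ^ 3) / 9 : ℚ) : ℚ_[3])‖ ≤ 1 := by
  obtain ⟨hA, hB⟩ := norm_shortModel_le_one_of_nine_dvd_conductorNorm W h9
  obtain ⟨hXn, hYn⟩ := norm_le_one_of_isShortThreeTorsion W hA hB hT
  have hsn := norm_tangentSlope_div_three_le_one hT hXn
  have hY27 := one_lt_norm_div_twentyseven_of_isShortThreeTorsion W hA hB hT
  obtain ⟨hc4, hc6, hΔ⟩ := c₄_c₆_Δ_eq_of_isShortThreeTorsion_flex W hT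
  set s : ℚ := tangentSlope W 1 X₁ Y₁ / 3 with hs
  have hY0 : Y₁ ≠ 0 := y_ne_zero_of_isShortThreeTorsion hT
  -- numeral valuations
  have v2 : padicValRat 3 (2 : ℚ) = 0 := by exact_mod_cast padicValRat_three_natCast_of_eq 0 (m := 2) (by norm_num) (by norm_num)
  have v4 : padicValRat 3 (4 : ℚ) = 0 := by exact_mod_cast padicValRat_three_natCast_of_eq 0 (m := 4) (by norm_num) (by norm_num)
  have v9 : padicValRat 3 (9 : ℚ) = 2 := by exact_mod_cast padicValRat_three_natCast_of_eq 2 (m := 1) (by norm_num) (by norm_num)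
  have v18 : padicValRat 3 (18 : ℚ) = 2 := by exact_mod_cast padicValRat_three_natCast_of_eq 2 (m := 2) (by norm_num) (by norm_num)
  have v27 : padicValRat 3 (27 : ℚ) = 3 := by exact_mod_cast padicValRat_three_natCast_of_eq 3 (m := 1) (by norm_num) (by norm_num)
  have v54 : padicValRat 3 (54 : ℚ) = 3 := by exact_mod_cast padicValRat_three_natCast_of_eq 3 (m := 2) (by norm_num) (by norm_num)
  have v144 : padicValRat 3 (144 : ℚ) = 2 := by exact_mod_cast padicValRat_three_natCast_of_eq 2 (m := 16) (by norm_num) (by norm_num)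
  have v432 : padicValRat 3 (432 : ℚ) = 3 := by exact_mod_cast padicValRat_three_natCast_of_eq 3 (m := 16) (by norm_num) (by norm_num)
  have v864 : padicValRat 3 (-864 : ℚ) = 3 := by
    rw [padicValRat.neg]; exact_mod_cast padicValRat_three_natCast_of_eq 3 (m := 32) (by norm_num) (by norm_num)
  -- valuations of the data
  have vY0 : 0 ≤ padicValRat 3 Y₁ := (norm_ratCast_padicThree_le_one_iff Y₁).mp hYn
  have vY2 : padicValRat 3 Y₁ ≤ 2 := by
    have h : ¬ 0 ≤ padicValRat 3 (Y₁ / 27) := fun h' ↦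
      (not_le.mpr hY27) ((norm_ratCast_padicThree_le_one_iff (Y₁ / 27)).mpr h')
    rw [padicValRat.div hY0 (by norm_num), v27] at h
    omega
  have vs : s = 0 ∨ 0 ≤ padicValRat 3 s := by
    by_cases h : s = 0
    · exact Or.inl h
    · exact Or.inr ((norm_ratCast_padicThree_le_one_iff s).mp hsn)
  have hD0 : 4 * s ^ 3 - Y₁ ≠ 0 := by
    intro h
    apply W.isUnit_Δ.ne_zero
    rw [hΔ, h, mul_zero]
  have hΔmin := padicValInt_minimalDiscriminantInt_eq_padicValRat_Δ W
  have vΔ : padicValRat 3 W.Δ = 3 + 3 * padicValRat 3 Y₁ + padicValRat 3 (4 * s ^ 3 - Y₁) := by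
    rw [hΔ, padicValRat_three_mul₃ (by norm_num) (pow_ne_zero 3 hY0) hD0, padicValRat.pow, v432]; push_cast; ring
  -- the goal in valuation terms
  have hne : Y₁ - 4 * s ^ 3 ≠ 0 := fun h ↦ hD0 (by linear_combination -h)
  suffices hv : 2 ≤ padicValRat 3 (Y₁ - 4 * s ^ 3) by
    apply (norm_ratCast_padicThree_le_one_iff _).mpr
    rw [padicValRat.div hne (by norm_num), v9]; omega
  by_contra hlt
  rw [not_le] at hlt
  have vdiff : padicValRat 3 (4 * s ^ 3 - Y₁) = padicValRat 3 (Y₁ - 4 * s ^ 3) := by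
    rw [← padicValRat.neg, neg_sub]
  -- `ord₃ (4s³ − Y₁) ≥ 0`
  have vD0 : 0 ≤ padicValRat 3 (4 * s ^ 3 - Y₁) := by
    apply (norm_ratCast_padicThree_le_one_iff _).mp
    push_cast
    have h4 : ‖(4 : ℚ_[3])‖ ≤ 1 := by
      have := norm_natCast_padicThree_eq_one (n := 4) (by norm_num)
      rw [Nat.cast_ofNat] at this; exact this.le
    calc ‖(4 : ℚ_[3]) * ((s : ℚ) : ℚ_[3]) ^ 3 - ((Y₁ : ℚ) : ℚ_[3])‖
        ≤ max ‖(4 : ℚ_[3]) * ((s : ℚ) : ℚ_[3]) ^ 3‖ ‖((Y₁ : ℚ) : ℚ_[3])‖ := by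
          rw [sub_eq_add_neg]
          exact (Padic.nonarchimedean _ _).trans (by rw [norm_neg])
      _ ≤ max 1 1 := by
          refine max_le_max ?_ hYn
          rw [norm_mul, norm_pow]
          exact mul_le_one₀ h4 (by positivity) (pow_le_one₀ (norm_nonneg _) hsn)
      _ = 1 := max_self 1
  -- the tame-type exhaustion at `3`
  have hex := padicValInt_three_minimalDiscriminantInt_of_nine_dvd_conductorNorm W h9 h27
  -- Case analysis on `ord₃ Y₁ ∈ {0, 1, 2}`
  have hYcases : padicValRat 3 Y₁ = 0 ∨ padicValRat 3 Y₁ = 1 ∨ padicValRat 3 Y₁ = 2 := by omega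
  rcases hYcases with hv0 | hv1 | hv2
  · -- Case A: `ord₃ Y₁ = 0`: `ord₃ Δ ∈ {3, 4}`
    have : padicValRat 3 W.Δ = 3 ∨ padicValRat 3 W.Δ = 4 := by omega
    rcases hex with ⟨-, h⟩ | ⟨-, h⟩ | ⟨-, h⟩ | ⟨n, -, h, -⟩ <;> omega
  · -- Case B: `ord₃ Y₁ = 1`
    by_cases hsz : s = 0
    · -- `s = 0`: `ord₃ Δ = 7`, and `c₄ = 0` so `j = 0`
      have hs3 : 4 * s ^ 3 - Y₁ = -Y₁ := by rw [hsz]; ring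
      have vD : padicValRat 3 (4 * s ^ 3 - Y₁) = 1 := by rw [hs3, padicValRat.neg, hv1]
      have hj : W.j = 0 := W.j_eq_zero (by rw [hc4, hsz]; ring)
      rcases hex with ⟨-, h⟩ | ⟨-, h⟩ | ⟨-, h⟩ | ⟨n, -, h, hjlt⟩
      · omega
      · omega
      · omega
      · rw [hj, padicValRat.zero] at hjlt; exact lt_irrefl _ hjlt
    have hs0 : 0 ≤ padicValRat 3 s := vs.resolve_left hsz
    -- `9s³ − 2Y₁ ≠ 0` with `ord₃ = 1`, in both remaining sub-cases (`ord₃ (9s³) ≥ 2 > 1 = ord₃ (2Y₁)`)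
    have h92 : 9 * s ^ 3 - 2 * Y₁ ≠ 0 ∧ padicValRat 3 (9 * s ^ 3 - 2 * Y₁) = 1 := by
      have hq : -(2 * Y₁) ≠ 0 := neg_ne_zero.mpr (mul_ne_zero two_ne_zero hY0)
      have hvq : padicValRat 3 (-(2 * Y₁)) = 1 := by rw [padicValRat.neg, padicValRat.mul two_ne_zero hY0, v2, hv1]; ring
      have h9s : padicValRat 3 (9 * s ^ 3) = 2 + 3 * padicValRat 3 s := by
        rw [padicValRat.mul (by norm_num) (pow_ne_zero 3 hsz), padicValRat.pow, v9]; push_cast; ring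
      have heq : padicValRat 3 (-(2 * Y₁) + 9 * s ^ 3) = 1 := by
        rw [padicValRat_three_add_eq_of_lt hq ?_, hvq]
        intro _; rw [hvq, h9s]; omega
      have e : 9 * s ^ 3 - 2 * Y₁ = -(2 * Y₁) + 9 * s ^ 3 := by ring
      refine ⟨?_, by rw [e, heq]⟩
      intro h0
      have : 9 * s ^ 3 = 2 * Y₁ := by linear_combination h0
      have hv' : padicValRat 3 (9 * s ^ 3) = padicValRat 3 (2 * Y₁) := by rw [this]
      rw [h9s, padicValRat.mul two_ne_zero hY0, v2, hv1] at hv'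
      omega
    have hc40 : W.c₄ ≠ 0 := by
      rw [hc4]; exact mul_ne_zero (mul_ne_zero (by norm_num) hsz) h92.1
    by_cases hsv : padicValRat 3 s = 0
    · -- Case B2: `s` a unit: the Papadopoulos–Rizzo triple `(3, 5, 6)` = type `IV`, against the tame types
      have vs3 : padicValRat 3 (4 * s ^ 3) = 0 := by
        rw [padicValRat.mul (by norm_num) (pow_ne_zero 3 hsz), padicValRat.pow, v4, hsv]; ring
      have vD : padicValRat 3 (4 * s ^ 3 - Y₁) = 0 := by
        rw [sub_eq_add_neg, padicValRat_three_add_eq_of_lt (mul_ne_zero (by norm_num) (pow_ne_zero 3 hsz)) ?_, vs3]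
        intro _; rw [vs3, padicValRat.neg, hv1]; norm_num
      have vΔ6 : padicValRat 3 W.Δ = 6 := by rw [vΔ, hv1, vD]; norm_num
      -- `ord₃ c₄ = 3`
      have vc4 : padicValRat 3 W.c₄ = 3 := by
        rw [hc4, padicValRat_three_mul₃ (by norm_num) hsz h92.1, v144, hsv, h92.2]; norm_num
      -- `ord₃ c₆ = 5`
      have hin : Y₁ ^ 2 - 18 * s ^ 3 * Y₁ + 54 * s ^ 6 ≠ 0 ∧
          padicValRat 3 (Y₁ ^ 2 - 18 * s ^ 3 * Y₁ + 54 * s ^ 6) = 2 := by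
        have hY2 : Y₁ ^ 2 ≠ 0 := pow_ne_zero 2 hY0
        have vY2' : padicValRat 3 (Y₁ ^ 2) = 2 := by rw [padicValRat.pow, hv1]; norm_num
        have e : Y₁ ^ 2 - 18 * s ^ 3 * Y₁ + 54 * s ^ 6 = Y₁ ^ 2 + (-(18 * s ^ 3 * Y₁) + 54 * s ^ 6) := by ring
        have hrest : -(18 * s ^ 3 * Y₁) + 54 * s ^ 6 ≠ 0 →
            padicValRat 3 (Y₁ ^ 2) < padicValRat 3 (-(18 * s ^ 3 * Y₁) + 54 * s ^ 6) := by
          intro hr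
          rw [vY2']
          have ha : padicValRat 3 (-(18 * s ^ 3 * Y₁)) = 3 := by
            rw [padicValRat.neg, padicValRat_three_mul₃ (by norm_num) (pow_ne_zero 3 hsz) hY0, padicValRat.pow,
              v18, hsv, hv1]; norm_num
          have hb : padicValRat 3 (54 * s ^ 6) = 3 := by
            rw [padicValRat.mul (by norm_num) (pow_ne_zero 6 hsz), padicValRat.pow, v54, hsv]; norm_num
          have hmin := padicValRat.min_le_padicValRat_add (p := 3) hr
          rw [ha, hb, min_self] at hmin
          omega
        have heq : padicValRat 3 (Y₁ ^ 2 + (-(18 * s ^ 3 * Y₁) + 54 * s ^ 6)) = 2 := by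
          rw [padicValRat_three_add_eq_of_lt hY2 hrest, vY2']
        refine ⟨?_, by rw [e, heq]⟩
        intro h0
        rw [e] at h0
        by_cases hr : -(18 * s ^ 3 * Y₁) + 54 * s ^ 6 = 0
        · rw [hr, add_zero] at h0; exact hY2 h0
        · have hlt' := hrest hr
          have : -(18 * s ^ 3 * Y₁) + 54 * s ^ 6 = -(Y₁ ^ 2) := by linear_combination h0
          rw [this, padicValRat.neg] at hlt'
          exact lt_irrefl _ hlt'
      have hc60 : W.c₆ ≠ 0 := by rw [hc6]; exact mul_ne_zero (by norm_num) hin.1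
      have vc6 : padicValRat 3 W.c₆ = 5 := by
        rw [hc6, padicValRat.mul (by norm_num) hin.1, v864, hin.2]; norm_num
      -- Rizzo's Table II (= Tate's algorithm at `3`, tree theorem), row `(3, 5, 6)`: type `IV`
      have hK : W.kodairaSymbolAt (placeOf 3) = .IV := by
        rw [W.kodairaSymbolAt_eq_tableKodairaSymbolThree (ringChar_int_quot_placeOf 3), tableKodairaSymbolThree_def,
          Rizzo.kodairaOfInvariants_eq_of_shift_zero (a := ((3 : ℤ) : WithTop ℤ)) (b := ((5 : ℤ) : WithTop ℤ)) (c := 6)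
            (k := 0) ?_ ?_ ?_ ?_]
        · exact Rizzo.kodaira_row_3_5_6 _ _ _
        · rw [Rizzo.val3, if_neg hc40, vc4]; rfl
        · rw [Rizzo.val3, if_neg hc60, vc6]; rfl
        · rw [vΔ6]; norm_num
        · decide
      rcases hex with ⟨h, -⟩ | ⟨h, -⟩ | ⟨h, -⟩ | ⟨n, h, -, -⟩ <;> rw [hK] at h <;> exact KodairaSymbol.noConfusion h
    · -- Case B1: `ord₃ s ≥ 1`: `ord₃ (4s³ − Y₁) = 1`, `ord₃ Δ = 7`, `ord₃ j ≥ 5` — no tame type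
      have hsv1 : 1 ≤ padicValRat 3 s := by omega
      have vD : padicValRat 3 (4 * s ^ 3 - Y₁) = 1 := by
        rw [show 4 * s ^ 3 - Y₁ = -Y₁ + 4 * s ^ 3 by ring,
          padicValRat_three_add_eq_of_lt (neg_ne_zero.mpr hY0) ?_, padicValRat.neg, hv1]
        intro _
        rw [padicValRat.neg, hv1, padicValRat.mul (by norm_num) (pow_ne_zero 3 hsz), padicValRat.pow, v4]
        push_cast; omega
      have vΔ7 : padicValRat 3 W.Δ = 7 := by rw [vΔ, hv1, vD]; norm_num
      have vc4 : 4 ≤ padicValRat 3 W.c₄ := by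
        rw [hc4, padicValRat_three_mul₃ (by norm_num) hsz h92.1, v144, h92.2]; omega
      have vj := padicValRat_three_j_eq W hc40
      rcases hex with ⟨-, h⟩ | ⟨-, h⟩ | ⟨-, h⟩ | ⟨n, -, h, hjlt⟩
      · omega
      · omega
      · omega
      · rw [vj, vΔ7] at hjlt; omega
  · -- Case C: `ord₃ Y₁ = 2`: `s` is a unit, `ord₃ Δ = 9`, `ord₃ j ≥ 3`: potentially good `III*` — no `3`-torsion (p3)
    have hs0' : s ≠ 0 := by
      intro h
      rw [h, show Y₁ - 4 * (0 : ℚ) ^ 3 = Y₁ by ring, hv2] at hlt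
      exact lt_irrefl _ hlt
    have hsv : padicValRat 3 s = 0 := by
      rcases vs with h | h
      · exact absurd h hs0'
      by_contra hne1
      have hsv1 : 1 ≤ padicValRat 3 s := by omega
      have : padicValRat 3 (Y₁ + -(4 * s ^ 3)) = 2 := by
        rw [padicValRat_three_add_eq_of_lt hY0 ?_, hv2]
        intro _
        rw [hv2, padicValRat.neg, padicValRat.mul (by norm_num) (pow_ne_zero 3 hs0'), padicValRat.pow, v4]
        push_cast; omega
      rw [← sub_eq_add_neg] at this
      rw [this] at hlt; exact lt_irrefl _ hlt
    have vs3 : padicValRat 3 (4 * s ^ 3) = 0 := by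
      rw [padicValRat.mul (by norm_num) (pow_ne_zero 3 hs0'), padicValRat.pow, v4, hsv]; ring
    have vD : padicValRat 3 (4 * s ^ 3 - Y₁) = 0 := by
      rw [sub_eq_add_neg, padicValRat_three_add_eq_of_lt (mul_ne_zero (by norm_num) (pow_ne_zero 3 hs0')) ?_, vs3]
      intro _; rw [vs3, padicValRat.neg, hv2]; norm_num
    have vΔ9 : padicValRat 3 W.Δ = 9 := by rw [vΔ, hv2, vD]; norm_num
    have hΔ9 : padicValInt 3 W.minimalDiscriminantInt = 9 := by
      have := hΔmin; rw [vΔ9] at this; exact_mod_cast this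
    -- `ord₃ j ≥ 0`
    have hj0 : 0 ≤ padicValRat 3 W.j := by
      by_cases h92 : 9 * s ^ 3 - 2 * Y₁ = 0
      · rw [W.j_eq_zero (by rw [hc4, h92, mul_zero]), padicValRat.zero]
      · have hc40 : W.c₄ ≠ 0 := by
          rw [hc4]; exact mul_ne_zero (mul_ne_zero (by norm_num) hs0') h92
        have v92 : 2 ≤ padicValRat 3 (9 * s ^ 3 - 2 * Y₁) := by
          have hmin := padicValRat.min_le_padicValRat_add (p := 3) (q := 9 * s ^ 3) (r := -(2 * Y₁))
            (by rw [← sub_eq_add_neg]; exact h92)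
          rw [padicValRat.neg, padicValRat.mul (by norm_num) (pow_ne_zero 3 hs0'), padicValRat.pow, v9, hsv,
            padicValRat.mul two_ne_zero hY0, v2, hv2, ← sub_eq_add_neg] at hmin
          norm_num at hmin
          exact hmin
        have vc4 : 4 ≤ padicValRat 3 W.c₄ := by
          rw [hc4, padicValRat_three_mul₃ (by norm_num) hs0' h92, v144, hsv]; omega
        rw [padicValRat_three_j_eq W hc40, vΔ9]; omega
    exact not_isShortThreeTorsion_of_IIIstar W h9 h27 hΔ9 hj0 X₁ Y₁ hT

end Summit.BirchSwinnertonDyer.BirchSwinnertonDyer.Theorems.ManinLocalTwoThree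

end
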